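import Summits.PneNP.PneNP.Theses.ORIncompressibility

/-!
# Route ORIncompressibility — `UntouchedBlock` (stmt-PneNP-0989)

Untouched-block lemma in the query model: `m` decision trees of depth `≤ D` on `t·n` bits with `m·D < t` (and `n > 0`)
read, on the all-`false` input `x`, fewer than `t` coordinates; some block `i₀` is unread, and flipping one of its bits
gives `y` with identical tree outputs, all blocks of `x` even and block `i₀` of `y` odd.
-/

set_option linter.dupNamespace false -- `Summit.PneNP.PneNP.…`: summit = sub-problem name (D-0017 single-conjunct layout)

namespace Summit.PneNP.PneNP.Theorems

open Finset
open Literature.Computability.Complexity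

/-- **The coordinates a decision tree reads on a fixed input**: a set of at most `depth` coordinates outside of which the
input may be changed without changing the output. [cite: Wolf2002, §2.1] -/
theorem decisionTree_exists_read_set {N : ℕ} (x : Fin N → Bool) (S : DecisionTree N) :
    ∃ Q : Finset (Fin N), Q.card ≤ S.depth ∧ ∀ y : Fin N → Bool, (∀ i ∈ Q, y i = x i) → S.eval y = S.eval x := by
  classical
  induction S with
  | leaf b => exact ⟨∅, by simp, fun y _ => rfl⟩
  | query i t₀ t₁ ih₀ ih₁ =>
    obtain ⟨Q₀, hQ₀, h₀⟩ := ih₀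
    obtain ⟨Q₁, hQ₁, h₁⟩ := ih₁
    by_cases hxi : x i = true
    · refine ⟨insert i Q₁, (card_insert_le _ _).trans ?_, fun y hy => ?_⟩
      · rw [DecisionTree.depth_query]; omega
      · have hyi : y i = true := by rw [hy i (mem_insert_self _ _)]; exact hxi
        simp only [DecisionTree.eval_query, hyi, hxi]
        exact h₁ y fun j hj => hy j (mem_insert_of_mem hj)
    · have hxi' : x i = false := by simpa using hxi
      refine ⟨insert i Q₀, (card_insert_le _ _).trans ?_, fun y hy => ?_⟩
      · rw [DecisionTree.depth_query]; omega
      · have hyi : y i = false := by rw [hy i (mem_insert_self _ _)]; exact hxi'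
        simp only [DecisionTree.eval_query, hyi, hxi']
        exact h₀ y fun j hj => hy j (mem_insert_of_mem hj)

/-- **Support item `UntouchedBlock` of route ORIncompressibility (stmt-PneNP-0989)**: `m` depth-`≤ D` decision trees on
`t·n` bits with `m·D < t`, `n > 0`, cannot separate the all-even input from some input with an odd block — an unread
block exists by pigeonhole and one of its bits is flipped. [cite: FortnowSanthanam2011, §1 (setting)] [folklore] -/
theorem orIncompressibility_untouchedBlock_proof : Summit.PneNP.PneNP.Theses.ORIncompressibility.UntouchedBlock := by
  unfold Summit.PneNP.PneNP.Theses.ORIncompressibility.UntouchedBlock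
  intro n t m D hn hmD T hT
  classical
  set x : Fin (t * n) → Bool := fun _ => false with hx
  choose Q hQcard hQeval using fun j => decisionTree_exists_read_set x (T j)
  set Qt : Finset (Fin (t * n)) := Finset.univ.biUnion Q with hQt
  have hQt_card : Qt.card < t :=
    calc Qt.card ≤ ∑ j, (Q j).card := card_biUnion_le
      _ ≤ ∑ _j : Fin m, D := sum_le_sum fun j _ => (hQcard j).trans (hT j)
      _ = m * D := by simp
      _ < t := hmD
  -- an unread block
  have hblock : ∃ i₀ : Fin t, ∀ q ∈ Qt, (finProdFinEquiv.symm q).1 ≠ i₀ := by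
    by_contra hall
    push Not at hall
    have hsurj : Finset.univ ⊆ Qt.image fun q => (finProdFinEquiv.symm q).1 := by
      intro i _
      obtain ⟨q, hq, hqi⟩ := hall i
      exact mem_image.2 ⟨q, hq, hqi⟩
    have := (card_le_card hsurj).trans card_image_le
    rw [card_univ, Fintype.card_fin] at this
    omega
  obtain ⟨i₀, hi₀⟩ := hblock
  set a : Fin (t * n) := finProdFinEquiv (i₀, ⟨0, hn⟩) with ha
  have haQ : a ∉ Qt := fun h => hi₀ a h (by rw [ha, Equiv.symm_apply_apply])
  set y : Fin (t * n) → Bool := Function.update x a true with hy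
  have hyx : ∀ i ∈ Qt, y i = x i := by
    intro i hi
    rw [hy, Function.update_of_ne]
    rintro rfl
    exact haQ hi
  refine ⟨x, y, fun j => ?_, fun i => ?_, i₀, ?_⟩
  · exact (hQeval j y fun i hi => hyx i (mem_biUnion.2 ⟨j, mem_univ _, hi⟩)).symm
  · simp [parityFn, GateFn.numOnes, hx]
  · have hvals : (fun l : Fin n => y (finProdFinEquiv (i₀, l))) = fun l => decide (l = ⟨0, hn⟩) := by
      funext l
      rw [hy]
      by_cases hl : l = ⟨0, hn⟩
      · subst hl
        rw [← ha, Function.update_self]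
        simp
      · rw [Function.update_of_ne]
        · simp [hx, hl]
        · intro h
          apply hl
          have := finProdFinEquiv.injective (h.trans ha)
          simpa using this
    rw [hvals]
    simp [parityFn, GateFn.numOnes, Finset.filter_eq']

end Summit.PneNP.PneNP.Theorems
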